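import Literature.NumberTheory.EllipticCurves.FunctionFieldEllipticLRegulatorProofs
import Literature.NumberTheory.EllipticCurves.FunctionFieldMordellWeilProofs
import Literature.NumberTheory.EllipticCurves.RegulatorProofs
import HarnessLib

/-!
# The regulator of an elliptic curve over a global function field is positive (proofs)

Sibling proof file of `Literature.NumberTheory.EllipticCurves.FunctionFieldEllipticL` (D-0014: the
facts there are named `def X : Prop`; discharges live in sibling files). It **discharges** the named
fact `Literature.NumberTheory.EllipticCurves.FunctionField.regulator_pos`:

*for an elliptic curve `E` (a Weierstrass curve `W` with `Δ ≠ 0`) over a global function field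
`F / 𝔽_q(T)`, `0 < regulator q W`* (`q = #𝔽_q`), i.e. the Néron–Tate pairing is positive definite
on the lattice `E(F)/E(F)_tors` and the regulator `det (⟨Pᵢ, Pⱼ⟩)` of a Mordell–Weil basis is the
determinant of a positive definite Gram matrix.

Sources. J. H. Silverman, *The Arithmetic of Elliptic Curves*, 2nd ed., §VIII.9: Thm. 9.3
(Néron–Tate), Lemma 9.5 (Cassels: a quadratic form on a lattice that is positive on non-zero
lattice points and has finite sublevel sets there is positive definite on the real span, by
Minkowski), Prop. 9.6 (*"the Néron–Tate height is a positive definite quadratic form on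
`E(K) ⊗ ℝ`"*) and Cor. 9.7 (*"The elliptic regulator satisfies `R_{E/K} > 0`"*, p. 253); the
proofs printed there use only Thm. 9.3, the finiteness of points of bounded height and
Lemma 9.5, hence hold verbatim over a global function field. D. Ulmer, *Park City lectures on
elliptic curves over function fields* (2011), Lecture 3, §4, Prop. 4.2 (the canonical height is
positive definite on `E(K)/tor ⊗ ℝ`, "nondegeneracy"), and *Curves and Jacobians over function
fields* (CRM Barcelona, 2014), §6.2.3 (the height pairing "makes `J_X(K)/tor` into a Euclidean
lattice"). T. Shioda, *On the Mordell–Weil lattices* (1990), Thm. 8.4.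

## Proof architecture (the printed proof of AEC Prop. VIII.9.6 / Cor. VIII.9.7, as glue)

Everything needed is already in the tree; this file mirrors, line by line, the number-field
discharge `WeierstrassCurve.regulator_pos_holds` of `RegulatorProofs` (AEC Cor. VIII.9.7 over a
number field), replacing each number-field input by its function-field twin:

1. **Cassels' lemma** (AEC Lemma VIII.9.5), field-free linear algebra: reused verbatim as
   `Matrix.IsSymm.posDef_of_forall_intCast_pos` of `RegulatorProofs`.
2. **`zᵀ (⟨Pᵢ, Pⱼ⟩) z = ĥ(∑ zᵢ Pᵢ)`** (bilinearity, AEC Thm. VIII.9.3(c), and `⟨P, P⟩ = ĥ(P)`): the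
   section `AnyField` below derives `ℤ`-linearity and finite additivity of the pairing in each
   variable from `heightPairing_add_left` / `heightPairing_comm` of
   `FunctionFieldEllipticLRegulatorProofs` (which take the exact parallelogram law as the
   hypothesis `hc : IsCanonicalHeightFor (naiveHeight q W) (canonicalHeight q W)` and hold over
   every field), and `⟨P, P⟩ = ĥ(P)` is the generic
   `Literature.NumberTheory.DiophantineGeometry.neronTatePairing_self`.
3. **Hypothesis (i) of Cassels' lemma** — `ĥ(∑ zᵢ Pᵢ) > 0` for `z ≠ 0` when the `Pᵢ` are independent
   modulo torsion: `ĥ ≥ 0` (`IsCanonicalHeightFor.nonneg`, the naive height being `≥ 0`,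
   `naiveHeight_nonneg`), `ĥ = 0` exactly on torsion (the discharged generic fact
   `IsCanonicalHeightFor.eq_zero_iff_isOfFinAddOrder_holds`, AEC Thm. VIII.9.3(d), which needs the
   Northcott property of the naive height), and `∑ zᵢ Pᵢ` torsion forces `z = 0` (the field-free
   `WeierstrassCurve.eq_zero_of_isOfFinAddOrder_sum_zsmul` of `RegulatorProofs`).
4. **Hypothesis (ii)** — `{z | ĥ(∑ zᵢ Pᵢ) ≤ B}` finite: Northcott for `ĥ`
   (`IsCanonicalHeightFor.finite_setOf_le`, AEC Thm. VIII.9.3(e) with Prop. VIII.6.1) pulled back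
   along the injection `z ↦ ∑ zᵢ Pᵢ` (injective modulo torsion, hence injective).
5. Over the global function field `F / 𝔽_q(T)` the two arithmetic inputs are the discharged facts
   `isCanonicalHeightFor_canonicalHeight_holds Fq W` (`FunctionFieldEllipticLHeightsProofs`: AEC
   Thm. VIII.6.2 along the product formula of `F`, then Tate's Thm. VIII.9.3) and Northcott's
   theorem `northcott_naiveHeight Fq W` (`FunctionFieldNorthcottProofs`); this gives
   `heightPairingMatrix_posDef` (AEC Prop. VIII.9.6 over `F`) and
   `regulatorOf_pos_of_isMordellWeilBasis` (Cor. VIII.9.7 for a basis).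
6. **Leaving the junk branch of `regulator`** (cf. AEC Remark VIII.9.4): a Mordell–Weil basis
   exists by the Lang–Néron theorem `exists_isMordellWeilBasis_of_functionField W Fq`
   (`FunctionFieldMordellWeilProofs`), and `regulator q W` is its regulator by the discharged
   independence `regulatorOf_eq_regulator_of_isMordellWeilBasis`
   (`FunctionFieldEllipticLRegulatorProofs`); whence `regulator_pos_holds`.

## Binders of the fact and of its discharge

Exactly as recorded in `FunctionFieldEllipticLRegulatorProofs` for the sibling fact
`regulatorOf_eq_regulator`: the `def` `regulator_pos` elaborates with the binders
`{F} [Field F] (Fq : Type) [Fintype Fq] (W)` (the constant field entering through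
`q = Fintype.card Fq`; `include Fq` does not reach `def`s), and the discharge below is stated, like
the accepted sibling discharges `hasApproxParallelogramLaw_naiveHeight_holds`,
`isCanonicalHeightFor_canonicalHeight_holds` and `regulatorOf_eq_regulator_holds`, under the
section's global-function-field instance stack
`[Field Fq] [Algebra Fq[X] F] [Algebra (RatFunc Fq) F] [IsScalarTower Fq[X] (RatFunc Fq) F]
[FunctionField Fq F]` — the standing hypothesis `K = 𝔽_q(𝒞)` of every source, and the only input
that is not pure algebra (product formula, Northcott, Lang–Néron). No hypothesis on `W` beyond the
fact's own `[W.IsElliptic]` binder is added; the fact is proved verbatim (no restatement, no new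
named fact).

## Mathlib search

Mathlib (pin v4.32.0) has no elliptic regulator / Néron–Tate pairing (grep `regulator`: only
`NumberField.Units.regulator`); used from Mathlib: `Matrix.PosDef.det_pos`, `Matrix.IsSymm`,
`dotProduct`, `Matrix.mulVec`, `Northcott`, `IsOfFinAddOrder`.

## References

* [SilvermanAEC2009] J. H. Silverman, *The Arithmetic of Elliptic Curves*, 2nd ed., GTM 106
  (2009), §VIII.9: Thm. 9.3, Lemma 9.5, Prop. 9.6, Cor. 9.7, pp. 248–253.
* [Ulmer2011ParkCity] D. Ulmer, *Elliptic curves over function fields*, IAS/Park City Math.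
  Ser. 18 (2011), Lecture 3, §4 (Prop. 4.2), arXiv:1101.1939.
* [Ulmer2014CRM] D. Ulmer, *Curves and Jacobians over function fields*, Adv. Courses Math. CRM
  Barcelona (2014), §6.2.3.
* [Shioda1990MWL] T. Shioda, *On the Mordell–Weil lattices*, Comment. Math. Univ. St. Pauli 39
  (1990), Thm. 8.4.
-/

noncomputable section

open scoped Classical Polynomial

open Matrix Literature.NumberTheory.DiophantineGeometry

namespace Literature.NumberTheory.EllipticCurves.FunctionField

/-! ### The quadratic form of the Gram matrix (every field, canonical height as hypothesis) -/

section AnyField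

variable {F : Type} [Field F] {q : ℕ} {W : WeierstrassCurve F}

/-- `⟨P, P⟩ = ĥ(P)` for the pairing of a canonical height (hypothesis `hc`): with the tree's
normalisation `⟨P, Q⟩ = (ĥ(P + Q) - ĥ(P) - ĥ(Q)) / 2` this is `ĥ(2P) = 4 ĥ(P)` (Silverman, AEC
Thm. VIII.9.3(b); the generic `neronTatePairing_self`). [cite: SilvermanAEC2009, Thm. VIII.9.3(b)] -/
theorem heightPairing_self (hc : IsCanonicalHeightFor (naiveHeight q W) (canonicalHeight q W))
    (P : W.toAffine.Point) : heightPairing q W P P = canonicalHeight q W P :=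
  neronTatePairing_self hc P

/-- Additivity in the second variable (from `heightPairing_add_left` by symmetry).
[cite: SilvermanAEC2009, Thm. VIII.9.3(c)] -/
theorem heightPairing_add_right (hc : IsCanonicalHeightFor (naiveHeight q W) (canonicalHeight q W))
    (P Q R : W.toAffine.Point) :
    heightPairing q W P (Q + R) = heightPairing q W P Q + heightPairing q W P R := by
  rw [heightPairing_comm, heightPairing_add_left hc, heightPairing_comm q W Q,
    heightPairing_comm q W R]

/-- `⟨n P, Q⟩ = n ⟨P, Q⟩` for `n : ℤ` (the pairing is additive, hence `ℤ`-linear, in the first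
variable). [cite: SilvermanAEC2009, Thm. VIII.9.3(c)] -/
theorem heightPairing_zsmul_left (hc : IsCanonicalHeightFor (naiveHeight q W) (canonicalHeight q W))
    (n : ℤ) (P Q : W.toAffine.Point) :
    heightPairing q W (n • P) Q = n * heightPairing q W P Q := by
  let f : W.toAffine.Point →+ ℝ :=
    AddMonoidHom.mk' (fun R => heightPairing q W R Q) fun R S => heightPairing_add_left hc R S Q
  have h := map_zsmul f n P
  rwa [zsmul_eq_mul] at h

/-- `⟨∑ᵢ Pᵢ, Q⟩ = ∑ᵢ ⟨Pᵢ, Q⟩`. [cite: SilvermanAEC2009, Thm. VIII.9.3(c)] -/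
theorem heightPairing_sum_left (hc : IsCanonicalHeightFor (naiveHeight q W) (canonicalHeight q W))
    {ι : Type*} (s : Finset ι) (P : ι → W.toAffine.Point) (Q : W.toAffine.Point) :
    heightPairing q W (∑ i ∈ s, P i) Q = ∑ i ∈ s, heightPairing q W (P i) Q := by
  let f : W.toAffine.Point →+ ℝ :=
    AddMonoidHom.mk' (fun R => heightPairing q W R Q) fun R S => heightPairing_add_left hc R S Q
  exact map_sum f P s

/-- `⟨P, n Q⟩ = n ⟨P, Q⟩` for `n : ℤ`. [cite: SilvermanAEC2009, Thm. VIII.9.3(c)] -/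
theorem heightPairing_zsmul_right
    (hc : IsCanonicalHeightFor (naiveHeight q W) (canonicalHeight q W)) (n : ℤ)
    (P Q : W.toAffine.Point) : heightPairing q W P (n • Q) = n * heightPairing q W P Q := by
  rw [heightPairing_comm, heightPairing_zsmul_left hc, heightPairing_comm]

/-- `⟨P, ∑ⱼ Qⱼ⟩ = ∑ⱼ ⟨P, Qⱼ⟩`. [cite: SilvermanAEC2009, Thm. VIII.9.3(c)] -/
theorem heightPairing_sum_right
    (hc : IsCanonicalHeightFor (naiveHeight q W) (canonicalHeight q W)) {ι : Type*} (s : Finset ι)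
    (P : W.toAffine.Point) (Q : ι → W.toAffine.Point) :
    heightPairing q W P (∑ j ∈ s, Q j) = ∑ j ∈ s, heightPairing q W P (Q j) := by
  rw [heightPairing_comm, heightPairing_sum_left hc]
  exact Finset.sum_congr rfl fun j _ => heightPairing_comm q W _ _

/-- **The quadratic form of the height pairing matrix on integer vectors is the canonical height**:
`zᵀ (⟨Pᵢ, Pⱼ⟩) z = ĥ(∑ᵢ zᵢ Pᵢ)` (bilinearity and `⟨P, P⟩ = ĥ(P)`; every field, canonical height as
hypothesis `hc`). Function-field twin of
`WeierstrassCurve.intCast_dotProduct_heightPairingMatrix_mulVec`.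
[cite: SilvermanAEC2009, Thm. VIII.9.3(c)] -/
theorem intCast_dotProduct_heightPairingMatrix_mulVec
    (hc : IsCanonicalHeightFor (naiveHeight q W) (canonicalHeight q W)) {ι : Type*} [Fintype ι]
    (P : ι → W.toAffine.Point) (z : ι → ℤ) :
    (fun i => (z i : ℝ)) ⬝ᵥ heightPairingMatrix q W P *ᵥ (fun i => (z i : ℝ)) =
      canonicalHeight q W (∑ i, z i • P i) := by
  rw [← heightPairing_self hc (∑ i, z i • P i), heightPairing_sum_left hc]
  simp only [dotProduct, Matrix.mulVec, heightPairingMatrix, Matrix.of_apply]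
  refine Finset.sum_congr rfl fun i _ => ?_
  rw [heightPairing_zsmul_left hc, heightPairing_sum_right hc]
  congr 1
  refine Finset.sum_congr rfl fun j _ => ?_
  rw [heightPairing_zsmul_right hc, mul_comm]

/-- **Silverman AEC Prop. VIII.9.6 over any field with a Northcott naive height and a canonical
height** (matrix form): for points `P₁, …, P_r ∈ E(F)` that are `ℤ`-linearly independent modulo
torsion, the height pairing matrix `(⟨Pᵢ, Pⱼ⟩)ᵢⱼ` is positive definite. Proof as printed: Cassels'
Lemma VIII.9.5 (`Matrix.IsSymm.posDef_of_forall_intCast_pos`) with (i) = Thm. VIII.9.3(c,d)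
(`IsCanonicalHeightFor.nonneg`, `IsCanonicalHeightFor.eq_zero_iff_isOfFinAddOrder_holds`) and
(ii) = Northcott for `ĥ` (`IsCanonicalHeightFor.finite_setOf_le`).
[cite: SilvermanAEC2009, Prop. VIII.9.6] -/
theorem heightPairingMatrix_posDef_of_isCanonicalHeightFor
    (hc : IsCanonicalHeightFor (naiveHeight q W) (canonicalHeight q W))
    [Northcott (naiveHeight q W)] {ι : Type*} [Fintype ι] {P : ι → W.toAffine.Point}
    (hP : LinearIndependent ℤ (QuotientAddGroup.mk ∘ P : ι → W.mordellWeilModTorsion)) :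
    (heightPairingMatrix q W P).PosDef := by
  have hb : BddBelow (Set.range (naiveHeight q W)) :=
    ⟨0, by rintro _ ⟨R, rfl⟩; exact naiveHeight_nonneg W q R⟩
  refine (heightPairingMatrix_isSymm W q P).posDef_of_forall_intCast_pos (fun z hz => ?_)
    (fun B => ?_)
  · rw [intCast_dotProduct_heightPairingMatrix_mulVec hc]
    refine lt_of_le_of_ne (hc.nonneg hb _) fun h => hz ?_
    exact WeierstrassCurve.eq_zero_of_isOfFinAddOrder_sum_zsmul hP
      ((IsCanonicalHeightFor.eq_zero_iff_isOfFinAddOrder_holds hc hb).mp h.symm)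
  · simp_rw [intCast_dotProduct_heightPairingMatrix_mulVec hc]
    have hinj : Function.Injective fun z : ι → ℤ => ∑ i, z i • P i := by
      intro z z' h
      dsimp only at h
      rw [← sub_eq_zero]
      refine WeierstrassCurve.eq_zero_of_isOfFinAddOrder_sum_zsmul hP ?_
      have e : ∑ i, (z - z') i • P i = ∑ i, z i • P i - ∑ i, z' i • P i := by
        simp only [Pi.sub_apply, sub_smul, Finset.sum_sub_distrib]
      rw [e, h, sub_self]
      exact IsOfFinAddOrder.zero
    exact (hc.finite_setOf_le B).preimage hinj.injOn

/-- **Silverman AEC Cor. VIII.9.7 for a family, over any field with a Northcott naive height and a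
canonical height**: the regulator `det (⟨Pᵢ, Pⱼ⟩)` of finitely many points independent modulo
torsion is positive (determinant of a positive definite matrix). [cite: SilvermanAEC2009, Cor. VIII.9.7] -/
theorem regulatorOf_pos_of_isCanonicalHeightFor
    (hc : IsCanonicalHeightFor (naiveHeight q W) (canonicalHeight q W))
    [Northcott (naiveHeight q W)] {ι : Type*} [Fintype ι] [DecidableEq ι]
    {P : ι → W.toAffine.Point}
    (hP : LinearIndependent ℤ (QuotientAddGroup.mk ∘ P : ι → W.mordellWeilModTorsion)) :
    0 < regulatorOf q W P := by
  rw [regulatorOf]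
  convert (heightPairingMatrix_posDef_of_isCanonicalHeightFor hc hP).det_pos

end AnyField

/-! ### Discharge over a global function field -/

section FunctionField

variable {F : Type} [Field F]
variable (Fq : Type) [Field Fq] [Fintype Fq]
variable [Algebra Fq[X] F] [Algebra (RatFunc Fq) F] [IsScalarTower Fq[X] (RatFunc Fq) F]
variable [FunctionField Fq F]
variable (W : WeierstrassCurve F)

variable {W} in
/-- **Silverman AEC Prop. VIII.9.6 over a global function field** (Ulmer (2011), Lecture 3,
Prop. 4.2; Ulmer (2014), §6.2.3: `E(F)/tors` is "a Euclidean lattice"): for an elliptic curve over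
`F / 𝔽_q(T)` and points `Pᵢ ∈ E(F)` independent modulo torsion, the Gram matrix `(⟨Pᵢ, Pⱼ⟩)ᵢⱼ` of
the Néron–Tate pairing (heights in units of `log q`, `q = #𝔽_q`) is positive definite. Inputs: the
canonical height of `E / F` (`isCanonicalHeightFor_canonicalHeight_holds`) and Northcott's theorem
for `E(F)` (`northcott_naiveHeight`). [cite: SilvermanAEC2009, Prop. VIII.9.6];
[cite: Ulmer2011ParkCity, Lecture 3, Prop. 4.2] -/
theorem heightPairingMatrix_posDef [W.IsElliptic] {ι : Type*} [Fintype ι]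
    {P : ι → W.toAffine.Point}
    (hP : LinearIndependent ℤ (QuotientAddGroup.mk ∘ P : ι → W.mordellWeilModTorsion)) :
    (heightPairingMatrix (Fintype.card Fq) W P).PosDef := by
  haveI := northcott_naiveHeight Fq W
  exact heightPairingMatrix_posDef_of_isCanonicalHeightFor
    (isCanonicalHeightFor_canonicalHeight_holds Fq W) hP

variable {W} in
/-- **Silverman AEC Cor. VIII.9.7 over a global function field, for a Mordell–Weil basis**:
`det (⟨Pᵢ, Pⱼ⟩) > 0`. [cite: SilvermanAEC2009, Cor. VIII.9.7] -/
theorem regulatorOf_pos_of_isMordellWeilBasis [W.IsElliptic] {ι : Type*} [Fintype ι]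
    [DecidableEq ι] {P : ι → W.toAffine.Point} (hP : WeierstrassCurve.IsMordellWeilBasis P) :
    0 < regulatorOf (Fintype.card Fq) W P := by
  haveI := northcott_naiveHeight Fq W
  exact regulatorOf_pos_of_isCanonicalHeightFor (isCanonicalHeightFor_canonicalHeight_holds Fq W)
    hP.1

/-- **Discharge of the named fact `regulator_pos`** of `FunctionFieldEllipticL` — **the regulator
of an elliptic curve over a global function field is positive, `Reg(E/F) > 0`** (Silverman, AEC
Cor. VIII.9.7, whose printed proof — Thm. VIII.9.3, Northcott, Cassels' Lemma VIII.9.5 by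
Minkowski, Prop. VIII.9.6 — is field-independent given those inputs; Ulmer (2011), Lecture 3, §4,
Prop. 4.2 (nondegeneracy of the canonical height pairing on `E(K)/tor`); Shioda (1990), Thm. 8.4).
Proof: by the Lang–Néron theorem (`exists_isMordellWeilBasis_of_functionField`) `E(F)` has a
Mordell–Weil basis `P`, so `regulator q W` leaves its junk branch and equals `det (⟨Pᵢ, Pⱼ⟩)`
(`regulatorOf_eq_regulator_of_isMordellWeilBasis`, independence of the basis), which is positive
by `regulatorOf_pos_of_isMordellWeilBasis`. The theorem carries the section's
global-function-field instance stack, as the sibling discharges of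
`FunctionFieldEllipticLHeightsProofs` / `FunctionFieldEllipticLRegulatorProofs` do (see the
module docstring). [cite: SilvermanAEC2009, Cor. VIII.9.7];
[cite: Ulmer2011ParkCity, Lecture 3, Prop. 4.2] -/
theorem regulator_pos_holds : regulator_pos Fq W := by
  intro _
  obtain ⟨n, P, hP⟩ := exists_isMordellWeilBasis_of_functionField W Fq
  rw [← regulatorOf_eq_regulator_of_isMordellWeilBasis Fq hP]
  exact regulatorOf_pos_of_isMordellWeilBasis Fq hP

/-- **`Reg(E/F) > 0`**, unpacked: for an elliptic curve `W` over the global function field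
`F / 𝔽_q(T)`, `0 < regulator (#𝔽_q) W`. [cite: SilvermanAEC2009, Cor. VIII.9.7] -/
theorem regulator_pos' [W.IsElliptic] : 0 < regulator (Fintype.card Fq) W :=
  regulator_pos_holds Fq W

/-- **`Reg(E/F) ≠ 0`** for an elliptic curve over a global function field.
[cite: SilvermanAEC2009, Cor. VIII.9.7] -/
theorem regulator_ne_zero [W.IsElliptic] : regulator (Fintype.card Fq) W ≠ 0 :=
  (regulator_pos' Fq W).ne'

end FunctionField

end Literature.NumberTheory.EllipticCurves.FunctionField

end
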